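import Mathlib

/-!
# NegationLens6g10 — kernel for `Cruxes/DescentPerfectToAll/NEGATION-lens6-g10.md` (res-B-lens-6 g10)

[OURS · CANDIDATE] counted 0; nothing here proves resolution in char p.  Resolution in
characteristic `p` is NOT proved.  This file proves NO statement about schemes.  It checks the
formal skeleton of the DIFFERENTIAL BUDGET of memo §1 (PROP I), i.e. the three facts about
one-variable power series over a ring of characteristic `p` and the counting recursion that
the hand argument reduces to:

* (K2) `d(ψ^p) = 0`, `d(φ·ψ^p) = ψ^p·dφ`, `d(φ − c − ψ^p) = dφ` for the formal derivative on
  `R⟦X⟧`, `CharP R p` — the re-presentation of the radicial datum at a birth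
  (`G ↦ G − γ^p − g^p`, choice of the tracked leaf representative) does not change `dG|_Γ`,
  and division by a `p`-th power multiplies `dG|_Γ` by that `p`-th power;
* (K3) `order φ ≤ order (dφ) + 1` (any commutative semiring), hence the CONTACT of every
  representative `φ − c − ψ^p` with the fixed curve is at most `order(dφ) + 1` — the budget
  `D = order (dG|_Γ)` is representative-free and caps the contact;
* (K4) over a field of characteristic `p`: `order d((X^k·η)^p·φ) = p·k + order dφ` for a unit
  `η` — the transformation law `D_{t+1} = D_t − p·k_t` of the budget under `h ↦ h/u^k`
  (read backwards: `G_t|_Γ = (w^k η)^p · G_{t+1}|_Γ`);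
* (K1) the counting recursion: if `D_{j+1} + Q_j = D_j` and `p ≤ Q_j` for `j < J` then
  `J·p + D_J ≤ D_0`, so `J ≤ D_0 / p` — the number of chain births after the first is at most
  `D/p`.

No `sorry`, Mathlib only.  Dictionary memo ↔ kernel: `X` ↔ the uniformiser `w` of the fixed
pointed curve germ `(Γ, P)`; `φ` ↔ `G_t|_Γ̃`; `d⁄dX` ↔ `d` on `𝒪̂_{Γ,P} = k[[w]]`.
-/

set_option linter.dupNamespace false

namespace Summit.ResolutionOfSingularities.ResolutionOfSingularities.Cruxes.DescentPerfectToAll.NegationLens6g10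

open PowerSeries

section K1

/-! ## K1. The counting recursion (memo §1, proof of PROP I, last step) -/

/-- If the budget satisfies `D (j+1) + Q j = D j` with every consumed contact `Q j ≥ p`
for `j < J`, then `J * p + D J ≤ D 0`. -/
theorem budget_recursion (p : ℕ) (D Q : ℕ → ℕ) (J : ℕ)
    (hrec : ∀ j < J, D (j + 1) + Q j = D j) (hQ : ∀ j < J, p ≤ Q j) :
    J * p + D J ≤ D 0 := by
  induction J with
  | zero => simp
  | succ J ih =>
    have h1 := ih (fun j hj => hrec j (by omega)) (fun j hj => hQ j (by omega))
    have h2 := hrec J (by omega)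
    have h3 := hQ J (by omega)
    rw [Nat.succ_mul]
    linarith

/-- Hence the number `J` of budget-consuming steps is at most `D 0 / p` (for `p ≥ 1`). -/
theorem chainBirths_le_div (p : ℕ) (hp : 0 < p) (D Q : ℕ → ℕ) (J : ℕ)
    (hrec : ∀ j < J, D (j + 1) + Q j = D j) (hQ : ∀ j < J, p ≤ Q j) :
    J ≤ D 0 / p := by
  have h := budget_recursion p D Q J hrec hQ
  exact (Nat.le_div_iff_mul_le hp).mpr (by linarith)

/-- The weaker form actually used: if the budget is non-increasing and drops by at least `p`
at each of `J` marked steps, then `J * p ≤ D 0 - D J`. -/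
theorem marked_drops_le (p : ℕ) (D : ℕ → ℕ) (J : ℕ)
    (hdrop : ∀ j < J, D (j + 1) + p ≤ D j) : J * p + D J ≤ D 0 := by
  induction J with
  | zero => simp
  | succ J ih =>
    have h1 := ih (fun j hj => hdrop j (by omega))
    have h2 := hdrop J (by omega)
    rw [Nat.succ_mul]
    linarith

end K1

section K2

/-! ## K2. `d` kills `p`-th powers (memo §1, (P0)/(D1)–(D3)) -/

variable {R : Type*} [CommRing R] (p : ℕ) [CharP R p]

/-- `d(ψ^p) = 0` in characteristic `p`. -/
theorem derivative_pow_p (ψ : R⟦X⟧) : d⁄dX R (ψ ^ p) = 0 := by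
  rw [Derivation.leibniz_pow, ← Nat.cast_smul_eq_nsmul R, CharP.cast_eq_zero R p, zero_smul]

/-- Division / multiplication by a `p`-th power commutes with `d`: `d(φ·ψ^p) = ψ^p·dφ`. -/
theorem derivative_mul_pow_p (φ ψ : R⟦X⟧) :
    d⁄dX R (φ * ψ ^ p) = ψ ^ p * d⁄dX R φ := by
  rw [Derivation.leibniz, derivative_pow_p p, smul_zero, zero_add, smul_eq_mul]

/-- Re-presentation at a birth (`G ↦ G − γ^p − g^p`) does not change `dG`. -/
theorem derivative_sub_C_sub_pow_p (φ ψ : R⟦X⟧) (c : R) :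
    d⁄dX R (φ - C c - ψ ^ p) = d⁄dX R φ := by
  rw [map_sub, map_sub, derivative_pow_p p, derivative_C, sub_zero, sub_zero]

end K2

section K3

/-! ## K3. The contact is capped by the budget: `order φ ≤ order (dφ) + 1` -/

variable {R : Type*}

/-- Over any commutative semiring: `order φ ≤ order φ' + 1`. -/
theorem order_le_order_derivative_add_one [CommSemiring R] (φ : R⟦X⟧) :
    φ.order ≤ (d⁄dX R φ).order + 1 := by
  by_cases h : d⁄dX R φ = 0
  · simp [h]
  · have hc := coeff_order h
    rw [coeff_derivative] at hc
    have hc' : coeff ((d⁄dX R φ).order.toNat + 1) φ ≠ 0 := fun h0 => hc (by rw [h0, zero_mul])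
    have h1 : φ.order ≤ ↑((d⁄dX R φ).order.toNat + 1) := order_le _ hc'
    have h2 : (((d⁄dX R φ).order.toNat : ℕ) : ℕ∞) = (d⁄dX R φ).order :=
      ENat.coe_toNat_eq_self.mpr (by simpa [order_eq_top] using h)
    calc φ.order ≤ ↑((d⁄dX R φ).order.toNat + 1) := h1
      _ = (d⁄dX R φ).order + 1 := by rw [Nat.cast_add, Nat.cast_one, h2]

/-- In characteristic `p`, EVERY representative `φ − c − ψ^p` of the leaf class has contact
(= order) at most `order(dφ) + 1`: the cap is representative-free. -/
theorem order_rep_le_order_derivative_add_one [CommRing R] (p : ℕ) [CharP R p]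
    (φ ψ : R⟦X⟧) (c : R) :
    (φ - C c - ψ ^ p).order ≤ (d⁄dX R φ).order + 1 := by
  have h := order_le_order_derivative_add_one (φ - C c - ψ ^ p)
  rwa [derivative_sub_C_sub_pow_p p] at h

end K3

section K4

/-! ## K4. Transformation law of the budget under `h ↦ h/u^k` (memo §1, (D2)) -/

variable {K : Type*} [Field K] (p : ℕ) [CharP K p]

/-- If `G_t|_Γ = (w^k·η)^p · G_{t+1}|_Γ` with `η` a unit (`order η = 0`), then
`order d(G_t|_Γ) = p·k + order d(G_{t+1}|_Γ)`, i.e. `D_{t+1} = D_t − p·k`. -/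
theorem order_derivative_transform (φ η : K⟦X⟧) (k : ℕ) (hη : η.order = 0) :
    (d⁄dX K ((X ^ k * η) ^ p * φ)).order = ↑(p * k) + (d⁄dX K φ).order := by
  rw [mul_comm ((X ^ k * η) ^ p) φ, derivative_mul_pow_p p, order_mul, order_pow, order_mul,
    order_X_pow, hη, add_zero]
  simp

/-- In particular the budget never increases under such a step. -/
theorem order_derivative_le_of_transform (φ η : K⟦X⟧) (k : ℕ) (hη : η.order = 0) :
    (d⁄dX K φ).order ≤ (d⁄dX K ((X ^ k * η) ^ p * φ)).order := by
  rw [order_derivative_transform p φ η k hη]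
  exact le_add_self

end K4

end Summit.ResolutionOfSingularities.ResolutionOfSingularities.Cruxes.DescentPerfectToAll.NegationLens6g10
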